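import Summits.HubbardSuperconductivity.HubbardSuperconductivity.Theorems.AnisotropyChordTransferFibre3FinXCCover

/-!
# Route `AnisotropyChord` / H0 rotor rung: FIN combined (rows `N₁` + C) certificate at `L = 9` — cell facts, part `s`

Kernel facts `xbcCellAny 9 (49/50) 20 la lb (c, bn) = true` (`decide +kernel`, zero data) for 8 λ-cells of the per-`L` cover
(`…FinXCCover.xbcCheck`; cell design: p3 g5 scratch `xbc_design.py`, mirrors `xb_mirror.py`/`xc_mirror.py`); assembled in `…FinXBCNine`.
Prover seat `hubbard-h0-rotor-p3` g5; helper for piece A = stmt-HubbardSuperconductivity-23918 of rung 19089 (`--supports`, helper class).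
WHAT THIS IS NOT: nothing here proves superconductivity in the Hubbard model (rotor TARGET as worded stays FALSE, g15 verdict); kernel facts for the FIN certificate of two hypotheses (rows `N₁`, C) of ONE conditional reduction.  Tree imports only; no sorry, no new axioms.
-/

set_option linter.dupNamespace false

namespace Summit.HubbardSuperconductivity.HubbardSuperconductivity.Theorems.AnisotropyChord.Transfer.Fibre3

namespace FinXB

set_option maxHeartbeats 4000000 in
/-- kernel fact: cell 156 at `L = 9` (certified, c = (9/20 : ℚ), b = 24/20). [folklore] -/
theorem xbc9_156 : xbcCellAny 9 (49/50 : ℚ) 20 28759721493091129 29104838151008221 ((9/20 : ℚ), (24 : ℕ)) = true := by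
  decide +kernel

set_option maxHeartbeats 4000000 in
/-- kernel fact: cell 157 at `L = 9` (certified, c = (9/20 : ℚ), b = 24/20). [folklore] -/
theorem xbc9_157 : xbcCellAny 9 (49/50 : ℚ) 20 29104838151008221 29454096208820321 ((9/20 : ℚ), (24 : ℕ)) = true := by
  decide +kernel

set_option maxHeartbeats 4000000 in
/-- kernel fact: cell 158 at `L = 9` (certified, c = (9/20 : ℚ), b = 25/20). [folklore] -/
theorem xbc9_158 : xbcCellAny 9 (49/50 : ℚ) 20 29454096208820321 29807545363326165 ((9/20 : ℚ), (25 : ℕ)) = true := by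
  decide +kernel

set_option maxHeartbeats 4000000 in
/-- kernel fact: cell 159 at `L = 9` (certified, c = (9/20 : ℚ), b = 25/20). [folklore] -/
theorem xbc9_159 : xbcCellAny 9 (49/50 : ℚ) 20 29807545363326165 30165235907686081 ((9/20 : ℚ), (25 : ℕ)) = true := by
  decide +kernel

set_option maxHeartbeats 4000000 in
/-- kernel fact: cell 160 at `L = 9` (certified, c = (9/20 : ℚ), b = 25/20). [folklore] -/
theorem xbc9_160 : xbcCellAny 9 (49/50 : ℚ) 20 30165235907686081 30527218738578313 ((9/20 : ℚ), (25 : ℕ)) = true := by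
  decide +kernel

set_option maxHeartbeats 4000000 in
/-- kernel fact: cell 161 at `L = 9` (certified, c = (9/20 : ℚ), b = 26/20). [folklore] -/
theorem xbc9_161 : xbcCellAny 9 (49/50 : ℚ) 20 30527218738578313 30893545363441253 ((9/20 : ℚ), (26 : ℕ)) = true := by
  decide +kernel

set_option maxHeartbeats 4000000 in
/-- kernel fact: cell 162 at `L = 9` (certified, c = (9/20 : ℚ), b = 26/20). [folklore] -/
theorem xbc9_162 : xbcCellAny 9 (49/50 : ℚ) 20 30893545363441253 31264267907802549 ((9/20 : ℚ), (26 : ℕ)) = true := by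
  decide +kernel

set_option maxHeartbeats 4000000 in
/-- kernel fact: cell 163 at `L = 9` (certified, c = (9/20 : ℚ), b = 26/20). [folklore] -/
theorem xbc9_163 : xbcCellAny 9 (49/50 : ℚ) 20 31264267907802549 31639439122696181 ((9/20 : ℚ), (26 : ℕ)) = true := by
  decide +kernel

end FinXB

end Summit.HubbardSuperconductivity.HubbardSuperconductivity.Theorems.AnisotropyChord.Transfer.Fibre3
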